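import Mathlib
import Literature.Computability.AlgebraicComplexity.GrenetProjection
import HarnessLib

/-!
# ProjOptimalUniqueWithoutPure

Topic `Literature/Uncategorized`. Named literature fact(s) relocated by the gate from `Summits/ValiantsHypothesis/ValiantsHypothesis/Theorems/ProjOptimalUnique/Negative/WithoutPure.lean`
(accept-time relocation of `[cite]`d propositions written inline in a Summits proposal; human ruling 2026-08-15).

* `Literature.Uncategorized.ProjOptimalUniqueWithoutPure`
-/

namespace Literature.Uncategorized

open Literature.Computability.AlgebraicComplexity

/-- `ProjOptimalUnique` with the projection ("pure") hypothesis on `A` and `B` WEAKENED to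
`IsAffineDetRepr` (affine entries, `det = per_n`); everything else — the size `pdc(per_n)`, the group
`GL × GL × permSymmetrySubst × ᵀ`, the conclusion — verbatim as in the route file. [folklore] -/
def ProjOptimalUniqueWithoutPure : Prop :=
  ∀ n ≥ 3, ∀ A B : Matrix (Fin (detProjectionComplexity (perPoly (Fin n) ℂ)))
      (Fin (detProjectionComplexity (perPoly (Fin n) ℂ))) (MvPolynomial (Fin n × Fin n) ℂ),
    IsAffineDetRepr (perPoly (Fin n) ℂ) A → IsAffineDetRepr (perPoly (Fin n) ℂ) B →
    ∃ (P Q : GL (Fin (detProjectionComplexity (perPoly (Fin n) ℂ))) ℂ) (γ : GL (Fin n × Fin n) ℂ),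
      γ ∈ permSymmetrySubst ℂ n ∧
      (B = (P : Matrix _ _ ℂ).map MvPolynomial.C * Matrix.linSubstEntries γ A *
          (Q : Matrix _ _ ℂ).map MvPolynomial.C ∨
       B = (P : Matrix _ _ ℂ).map MvPolynomial.C * (Matrix.linSubstEntries γ A).transpose *
          (Q : Matrix _ _ ℂ).map MvPolynomial.C)

end Literature.Uncategorized
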